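import Literature.Analysis.FluidPDE.PlanarStreamGluing
import HarnessLib

/-!
# Assembling simultaneous explicit moves: the glued scalar, stream function and velocity

Topic `Literature/Analysis/FluidPDE`. Sixth file of the explicit pullback calculus for the planar
transport equation (`PlanarPullbackKinematics`, `PlanarPullbackTransport`,
`PlanarGraphBandKinematics`, `PlanarDiagonalFrame`, `PlanarCornerElement`, `PlanarStreamGluing`).
A rectilinear channel at a given stage of an explicit isotopy is a chain of `K` elements
(straight runs, corners, stubs, …), element `k` coming with its own explicit scalar `Θ_k(t, z)`,
stream function `H_k(t, z)` and space-time cut-off `χ_k(t, z)`. This file defines the assembled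
fields

  `Θ(t,z) = Σ_{k<K} χ_k Θ_k`,  `Ĥ(t,z) = H₀ + Σ_{k<K} χ_k (H_k - H₀)`,  `V(t,·) = ∇⊥ Ĥ(t,·)`

(`assembledScalar`, `assembledStream`, `assembledVelocity`) and proves, abstractly in the
families `(χ, Θ, H)`:

* smoothness of `Θ`, `Ĥ`, `V` from that of the families (`contDiff_uncurry_assembled…`), and
  incompressibility of `V` everywhere (`divergence_assembledVelocity`, a perpendicular gradient);
* **transport from local cases** — the pointwise heart of every later assembly: at a space-time
  point `(t, z)`, `∂ₜΘ + D_zΘ[V] = 0` holds as soon as ONE of the following local situations is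
  certified: a *core* point of an element `k` (`χ_k = 1` and all other cut-offs vanish near
  `(t,z)`, and `Θ_k` is transported by `∇⊥H_k` at `(t,z)`; `transport_assembled_of_core`), a
  *junction* point of two consecutive elements (`χ_k + χ_{k+1} = 1`, the two elements agree near
  `(t,z)`, the other cut-offs vanish; `transport_assembled_of_junction`), or a *far* point
  (every `χ_j Θ_j` vanishes near `(t,z)`; `transport_assembled_of_far`); the three cases are
  packaged in `AssemblyCase` / `transport_assembled_of_case`;
* the corresponding pointwise facts for the bound `|Θ| ≤ M` (`abs_assembledScalar_le_…`) and for
  the vanishing of the velocity where `Ĥ` is locally the background constant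
  (`assembledVelocity_eq_zero_of_far`) — the form in which tangency and the boundary-strip
  clauses of `QuasiSelfSimilar.IsCompatibleBlockSystem` are met — and local agreement with a
  prescribed pair near a point (`assembled_eq_of_core`, for the gate windows).

Which case holds where is a matter of boxes and margins (the next file); here everything is
filters and finite sums. Folklore; the file states no named fact. Infrastructure towards a
discharge of `acm_compatible_blocks` (`QuasiSelfSimilarCompatibleBlocks.lean`).

## References

* G. Alberti, G. Crippa, A. L. Mazzucato, *Exponential self-similar mixing by incompressible
  flows*, J. Amer. Math. Soc. 32 (2019), 445–490, §§7–8 (arXiv:1605.02090).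
-/

noncomputable section

open Function Set Filter
open scoped Topology ContDiff

namespace Literature.Analysis.FluidPDE

namespace PlanarKinematics

/-- The plane `ℝ²` as a Euclidean space. [folklore] -/
local notation "E²" => EuclideanSpace ℝ (Fin 2)

section Assembly

variable (K : ℕ) (H₀ : ℝ) (χ Θ H : ℕ → ℝ → E² → ℝ)

/-! ## The assembled fields -/

/-- **Assembled scalar** `Θ(t, z) = Σ_{k<K} χ_k(t,z) Θ_k(t,z)`. [folklore] -/
def assembledScalar (t : ℝ) (z : E²) : ℝ :=
  glueScalar K (fun k w => χ k t w) (fun k w => Θ k t w) z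

/-- **Assembled stream function** `Ĥ(t, z) = H₀ + Σ_{k<K} χ_k(t,z) (H_k(t,z) - H₀)`. [folklore] -/
def assembledStream (t : ℝ) (z : E²) : ℝ :=
  glueStream K H₀ (fun k w => χ k t w) (fun k w => H k t w) z

/-- **Assembled velocity** `V(t, ·) = ∇⊥ Ĥ(t, ·)`. [folklore] -/
def assembledVelocity (t : ℝ) (z : E²) : E² :=
  perpGrad (assembledStream K H₀ χ H t) z

/-- Unfolding the assembled scalar. [folklore] -/
theorem assembledScalar_apply (t : ℝ) (z : E²) :
    assembledScalar K χ Θ t z = ∑ k ∈ Finset.range K, χ k t z * Θ k t z := rfl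

/-- Unfolding the assembled stream function. [folklore] -/
theorem assembledStream_apply (t : ℝ) (z : E²) :
    assembledStream K H₀ χ H t z = H₀ + ∑ k ∈ Finset.range K, χ k t z * (H k t z - H₀) := rfl

/-- Unfolding the assembled velocity. [folklore] -/
theorem assembledVelocity_apply (t : ℝ) (z : E²) :
    assembledVelocity K H₀ χ H t z = perpGrad (assembledStream K H₀ χ H t) z := rfl

/-! ## Smoothness and incompressibility -/

/-- **The assembled scalar is smooth** when all cut-offs and element scalars are (jointly in
`(t, z)`). [folklore] -/
theorem contDiff_uncurry_assembledScalar (hχ : ∀ k < K, ContDiff ℝ ∞ (uncurry (χ k)))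
    (hΘ : ∀ k < K, ContDiff ℝ ∞ (uncurry (Θ k))) : ContDiff ℝ ∞ (uncurry (assembledScalar K χ Θ)) := by
  have e : uncurry (assembledScalar K χ Θ) =
      fun p : ℝ × E² => ∑ k ∈ Finset.range K, uncurry (χ k) p * uncurry (Θ k) p := by
    funext p; rfl
  rw [e]
  exact ContDiff.sum fun k hk => (hχ k (Finset.mem_range.1 hk)).mul (hΘ k (Finset.mem_range.1 hk))

/-- **The assembled stream function is smooth** when all cut-offs and element stream functions
are. [folklore] -/
theorem contDiff_uncurry_assembledStream (hχ : ∀ k < K, ContDiff ℝ ∞ (uncurry (χ k)))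
    (hH : ∀ k < K, ContDiff ℝ ∞ (uncurry (H k))) : ContDiff ℝ ∞ (uncurry (assembledStream K H₀ χ H)) := by
  have e : uncurry (assembledStream K H₀ χ H) =
      fun p : ℝ × E² => H₀ + ∑ k ∈ Finset.range K, uncurry (χ k) p * (uncurry (H k) p - H₀) := by
    funext p; rfl
  rw [e]
  exact contDiff_const.add
    (ContDiff.sum fun k hk => (hχ k (Finset.mem_range.1 hk)).mul ((hH k (Finset.mem_range.1 hk)).sub contDiff_const))

/-- **The assembled velocity is smooth.** [folklore] -/
theorem contDiff_uncurry_assembledVelocity (hχ : ∀ k < K, ContDiff ℝ ∞ (uncurry (χ k)))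
    (hH : ∀ k < K, ContDiff ℝ ∞ (uncurry (H k))) : ContDiff ℝ ∞ (uncurry (assembledVelocity K H₀ χ H)) :=
  contDiff_uncurry_perpGrad (contDiff_uncurry_assembledStream K H₀ χ H hχ hH)

/-- **The assembled velocity is divergence free everywhere** (a perpendicular gradient of a smooth
stream function). [folklore] -/
theorem divergence_assembledVelocity (hχ : ∀ k < K, ContDiff ℝ ∞ (uncurry (χ k)))
    (hH : ∀ k < K, ContDiff ℝ ∞ (uncurry (H k))) (t : ℝ) (z : E²) :
    ∑ j, fderiv ℝ (assembledVelocity K H₀ χ H t) z (EuclideanSpace.single j 1) j = 0 :=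
  divergence_perpGrad_of_contDiff_uncurry (contDiff_uncurry_assembledStream K H₀ χ H hχ hH) t z

/-! ## Local identification of the assembled fields -/

variable {K H₀ χ Θ H}

/-- A space-time eventual statement restricts to the time slice. [folklore] -/
theorem eventually_slice {P : ℝ → E² → Prop} {t : ℝ} {z : E²} (h : ∀ᶠ p in 𝓝 (t, z), P p.1 p.2) :
    ∀ᶠ w in 𝓝 z, P t w :=
  ((tendsto_const_nhds.prodMk_nhds tendsto_id : Tendsto (fun w : E² => (t, w)) (𝓝 z) (𝓝 (t, z))).eventually h).mono
    fun _ hw => hw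

/-- **On a core the assembled fields are the fields of the element**: if near `(t,z)` the cut-off
of element `k` is `1` and all other cut-offs vanish, then near `(t,z)` the assembled scalar is
`Θ_k` and the assembled stream function is `H_k`. [folklore] -/
theorem assembled_eq_of_core {t : ℝ} {z : E²} {k : ℕ} (hk : k < K)
    (h1 : ∀ᶠ p in 𝓝 (t, z), χ k p.1 p.2 = 1)
    (h0 : ∀ j < K, j ≠ k → ∀ᶠ p in 𝓝 (t, z), χ j p.1 p.2 = 0) :
    (∀ᶠ p in 𝓝 (t, z), assembledScalar K χ Θ p.1 p.2 = Θ k p.1 p.2) ∧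
      ∀ᶠ p in 𝓝 (t, z), assembledStream K H₀ χ H p.1 p.2 = H k p.1 p.2 := by
  -- gather the finitely many vanishing statements into one eventual statement
  have h0' : ∀ᶠ p in 𝓝 (t, z), ∀ j ∈ (Finset.range K).erase k, χ j p.1 p.2 = 0 := by
    rw [Filter.eventually_all_finset]
    intro j hj
    rw [Finset.mem_erase, Finset.mem_range] at hj
    exact h0 j hj.2 hj.1
  have key := h1.and h0'
  constructor
  · refine key.mono fun p hp => ?_
    exact (glue_eq_of_core (Θ := fun j w => Θ j p.1 w) (H := fun j w => H j p.1 w) (H₀ := H₀) hk hp.1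
      (fun j hj hjk => hp.2 j (Finset.mem_erase.2 ⟨hjk, Finset.mem_range.2 hj⟩))).1
  · refine key.mono fun p hp => ?_
    exact (glue_eq_of_core (Θ := fun j w => Θ j p.1 w) (H := fun j w => H j p.1 w) (H₀ := H₀) hk hp.1
      (fun j hj hjk => hp.2 j (Finset.mem_erase.2 ⟨hjk, Finset.mem_range.2 hj⟩))).2

/-- **On a junction the assembled fields are the common fields of the two elements**: if near
`(t,z)` the cut-offs of the consecutive elements `k`, `k+1` add up to `1`, all other cut-offs
vanish, and the two elements agree, then near `(t,z)` the assembled scalar is `Θ_k` and the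
assembled stream function is `H_k`. [folklore] -/
theorem assembled_eq_of_junction {t : ℝ} {z : E²} {k : ℕ} (hk : k + 1 < K)
    (h1 : ∀ᶠ p in 𝓝 (t, z), χ k p.1 p.2 + χ (k + 1) p.1 p.2 = 1)
    (h0 : ∀ j < K, j ≠ k → j ≠ k + 1 → ∀ᶠ p in 𝓝 (t, z), χ j p.1 p.2 = 0)
    (hΘ : ∀ᶠ p in 𝓝 (t, z), Θ (k + 1) p.1 p.2 = Θ k p.1 p.2)
    (hH : ∀ᶠ p in 𝓝 (t, z), H (k + 1) p.1 p.2 = H k p.1 p.2) :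
    (∀ᶠ p in 𝓝 (t, z), assembledScalar K χ Θ p.1 p.2 = Θ k p.1 p.2) ∧
      ∀ᶠ p in 𝓝 (t, z), assembledStream K H₀ χ H p.1 p.2 = H k p.1 p.2 := by
  have h0' : ∀ᶠ p in 𝓝 (t, z), ∀ j ∈ ((Finset.range K).erase k).erase (k + 1), χ j p.1 p.2 = 0 := by
    rw [Filter.eventually_all_finset]
    intro j hj
    simp only [Finset.mem_erase, Finset.mem_range] at hj
    exact h0 j hj.2.2 hj.2.1 hj.1
  have key := (h1.and h0').and (hΘ.and hH)
  have hmem : ∀ {p : ℝ × E²}, (∀ j ∈ ((Finset.range K).erase k).erase (k + 1), χ j p.1 p.2 = 0) →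
      ∀ j < K, j ≠ k → j ≠ k + 1 → χ j p.1 p.2 = 0 := fun hp j hj hjk hjk1 =>
    hp j (Finset.mem_erase.2 ⟨hjk1, Finset.mem_erase.2 ⟨hjk, Finset.mem_range.2 hj⟩⟩)
  constructor
  · refine key.mono fun p hp => ?_
    exact (glue_eq_of_junction (Θ := fun j w => Θ j p.1 w) (H := fun j w => H j p.1 w) (H₀ := H₀) hk hp.1.1
      (hmem hp.1.2) hp.2.1 hp.2.2).1
  · refine key.mono fun p hp => ?_
    exact (glue_eq_of_junction (Θ := fun j w => Θ j p.1 w) (H := fun j w => H j p.1 w) (H₀ := H₀) hk hp.1.1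
      (hmem hp.1.2) hp.2.1 hp.2.2).2

/-- **Far from all tubes the assembled scalar vanishes**: if near `(t,z)` every product `χ_j Θ_j`
vanishes, the assembled scalar vanishes near `(t,z)`. [folklore] -/
theorem assembledScalar_eq_zero_of_far {t : ℝ} {z : E²}
    (h0 : ∀ j < K, ∀ᶠ p in 𝓝 (t, z), χ j p.1 p.2 * Θ j p.1 p.2 = 0) :
    ∀ᶠ p in 𝓝 (t, z), assembledScalar K χ Θ p.1 p.2 = 0 := by
  have h0' : ∀ᶠ p in 𝓝 (t, z), ∀ j ∈ Finset.range K, χ j p.1 p.2 * Θ j p.1 p.2 = 0 := by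
    rw [Filter.eventually_all_finset]
    exact fun j hj => h0 j (Finset.mem_range.1 hj)
  refine h0'.mono fun p hp => ?_
  rw [assembledScalar_apply]
  exact Finset.sum_eq_zero hp

/-- **Far from all elements the assembled stream function is the background constant**: if near
`z` (at time `t`) every product `χ_j (H_j - H₀)` vanishes, then `Ĥ(t,·) = H₀` near `z`. [folklore] -/
theorem assembledStream_eq_const_of_far {t : ℝ} {z : E²}
    (h0 : ∀ j < K, ∀ᶠ w in 𝓝 z, χ j t w * (H j t w - H₀) = 0) :
    assembledStream K H₀ χ H t =ᶠ[𝓝 z] fun _ => H₀ := by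
  have h0' : ∀ᶠ w in 𝓝 z, ∀ j ∈ Finset.range K, χ j t w * (H j t w - H₀) = 0 := by
    rw [Filter.eventually_all_finset]
    exact fun j hj => h0 j (Finset.mem_range.1 hj)
  refine h0'.mono fun w hw => ?_
  rw [assembledStream_apply, Finset.sum_eq_zero hw, add_zero]

/-! ## Transport from local cases -/

/-- **Transport at a core point**: if near `(t,z)` element `k` carries cut-off `1` and all other
cut-offs vanish, and `Θ_k` is transported by `∇⊥H_k` at `(t,z)`, then the assembled scalar is
transported by the assembled velocity at `(t,z)`. [folklore] -/
theorem transport_assembled_of_core {t : ℝ} {z : E²} {k : ℕ} (hk : k < K)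
    (h1 : ∀ᶠ p in 𝓝 (t, z), χ k p.1 p.2 = 1)
    (h0 : ∀ j < K, j ≠ k → ∀ᶠ p in 𝓝 (t, z), χ j p.1 p.2 = 0)
    (htr : deriv (fun s => Θ k s z) t + fderiv ℝ (Θ k t) z (perpGrad (H k t) z) = 0) :
    deriv (fun s => assembledScalar K χ Θ s z) t +
      fderiv ℝ (assembledScalar K χ Θ t) z (assembledVelocity K H₀ χ H t z) = 0 := by
  obtain ⟨hΘ, hH⟩ := assembled_eq_of_core (Θ := Θ) (H := H) (H₀ := H₀) hk h1 h0
  exact transport_perpGrad_of_local hΘ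
    (eventually_slice (P := fun s w => assembledStream K H₀ χ H s w = H k s w) hH) htr

/-- **Transport at a junction point**: if near `(t,z)` two consecutive elements carry cut-offs
adding up to `1`, agree, and all other cut-offs vanish, and `Θ_k` is transported by `∇⊥H_k` at
`(t,z)`, then the assembled scalar is transported by the assembled velocity at `(t,z)`. [folklore] -/
theorem transport_assembled_of_junction {t : ℝ} {z : E²} {k : ℕ} (hk : k + 1 < K)
    (h1 : ∀ᶠ p in 𝓝 (t, z), χ k p.1 p.2 + χ (k + 1) p.1 p.2 = 1)
    (h0 : ∀ j < K, j ≠ k → j ≠ k + 1 → ∀ᶠ p in 𝓝 (t, z), χ j p.1 p.2 = 0)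
    (hΘk : ∀ᶠ p in 𝓝 (t, z), Θ (k + 1) p.1 p.2 = Θ k p.1 p.2)
    (hHk : ∀ᶠ p in 𝓝 (t, z), H (k + 1) p.1 p.2 = H k p.1 p.2)
    (htr : deriv (fun s => Θ k s z) t + fderiv ℝ (Θ k t) z (perpGrad (H k t) z) = 0) :
    deriv (fun s => assembledScalar K χ Θ s z) t +
      fderiv ℝ (assembledScalar K χ Θ t) z (assembledVelocity K H₀ χ H t z) = 0 := by
  obtain ⟨hΘ, hH⟩ := assembled_eq_of_junction (Θ := Θ) (H := H) (H₀ := H₀) hk h1 h0 hΘk hHk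
  exact transport_perpGrad_of_local hΘ
    (eventually_slice (P := fun s w => assembledStream K H₀ χ H s w = H k s w) hH) htr

/-- **Transport far from the tubes**: if near `(t,z)` every product `χ_j Θ_j` vanishes, the
assembled scalar is transported at `(t,z)` (by any velocity, in particular by the assembled one).
[folklore] -/
theorem transport_assembled_of_far {t : ℝ} {z : E²}
    (h0 : ∀ j < K, ∀ᶠ p in 𝓝 (t, z), χ j p.1 p.2 * Θ j p.1 p.2 = 0) :
    deriv (fun s => assembledScalar K χ Θ s z) t +
      fderiv ℝ (assembledScalar K χ Θ t) z (assembledVelocity K H₀ χ H t z) = 0 :=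
  transport_perpGrad_of_eventually_eq_zero (assembledStream K H₀ χ H)
    (assembledScalar_eq_zero_of_far (χ := χ) (Θ := Θ) h0)

/-- **The three local cases** at a space-time point that certify transport of the assembled
fields there: a core point of some element, a junction point of two consecutive elements, or a
point far from all tubes. [folklore] -/
inductive AssemblyCase (K : ℕ) (χ Θ H : ℕ → ℝ → E² → ℝ) (t : ℝ) (z : E²) : Prop
  /-- core point of element `k` -/
  | core (k : ℕ) (hk : k < K) (h1 : ∀ᶠ p in 𝓝 (t, z), χ k p.1 p.2 = 1)
      (h0 : ∀ j < K, j ≠ k → ∀ᶠ p in 𝓝 (t, z), χ j p.1 p.2 = 0)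
      (htr : deriv (fun s => Θ k s z) t + fderiv ℝ (Θ k t) z (perpGrad (H k t) z) = 0) :
      AssemblyCase K χ Θ H t z
  /-- junction point of elements `k`, `k+1` -/
  | junction (k : ℕ) (hk : k + 1 < K) (h1 : ∀ᶠ p in 𝓝 (t, z), χ k p.1 p.2 + χ (k + 1) p.1 p.2 = 1)
      (h0 : ∀ j < K, j ≠ k → j ≠ k + 1 → ∀ᶠ p in 𝓝 (t, z), χ j p.1 p.2 = 0)
      (hΘk : ∀ᶠ p in 𝓝 (t, z), Θ (k + 1) p.1 p.2 = Θ k p.1 p.2)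
      (hHk : ∀ᶠ p in 𝓝 (t, z), H (k + 1) p.1 p.2 = H k p.1 p.2)
      (htr : deriv (fun s => Θ k s z) t + fderiv ℝ (Θ k t) z (perpGrad (H k t) z) = 0) :
      AssemblyCase K χ Θ H t z
  /-- far point -/
  | far (h0 : ∀ j < K, ∀ᶠ p in 𝓝 (t, z), χ j p.1 p.2 * Θ j p.1 p.2 = 0) : AssemblyCase K χ Θ H t z

/-- **Transport of the assembled fields from a local case.** [folklore] -/
theorem transport_assembled_of_case {t : ℝ} {z : E²} (h : AssemblyCase K χ Θ H t z) :
    deriv (fun s => assembledScalar K χ Θ s z) t +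
      fderiv ℝ (assembledScalar K χ Θ t) z (assembledVelocity K H₀ χ H t z) = 0 := by
  rcases h with ⟨k, hk, h1, h0, htr⟩ | ⟨k, hk, h1, h0, hΘk, hHk, htr⟩ | ⟨h0⟩
  · exact transport_assembled_of_core hk h1 h0 htr
  · exact transport_assembled_of_junction hk h1 h0 hΘk hHk htr
  · exact transport_assembled_of_far h0

/-- **Transport on a region from a local case at every point** (the form in which the clause
`transport` of a generator move is met on `[0,1] × [0,1]²`). [folklore] -/
theorem transport_assembled_on {S : Set ℝ} {Q : Set E²}
    (h : ∀ t ∈ S, ∀ z ∈ Q, AssemblyCase K χ Θ H t z) :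
    ∀ t ∈ S, ∀ z ∈ Q, deriv (fun s => assembledScalar K χ Θ s z) t +
      fderiv ℝ (assembledScalar K χ Θ t) z (assembledVelocity K H₀ χ H t z) = 0 :=
  fun t ht z hz => transport_assembled_of_case (h t ht z hz)

/-! ## Pointwise bounds and vanishing of the velocity -/

/-- **Bound at a core point**: `|Θ(t,z)| ≤ M` if `χ_k(t,z) = 1`, the other cut-offs vanish at
`(t,z)` and `|Θ_k(t,z)| ≤ M`. [folklore] -/
theorem abs_assembledScalar_le_of_core {t : ℝ} {z : E²} {k : ℕ} {M : ℝ} (hk : k < K)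
    (h1 : χ k t z = 1) (h0 : ∀ j < K, j ≠ k → χ j t z = 0) (hM : |Θ k t z| ≤ M) :
    |assembledScalar K χ Θ t z| ≤ M := by
  have e := (glue_eq_of_core (Θ := fun j w => Θ j t w) (H := fun _ _ => (0 : ℝ)) (H₀ := 0) (x := z) hk h1 h0).1
  have e' : assembledScalar K χ Θ t z = Θ k t z := e
  rw [e']; exact hM

/-- **Bound at a junction point**: `|Θ(t,z)| ≤ M` if `χ_k + χ_{k+1} = 1` at `(t,z)`, the two
elements agree there, the other cut-offs vanish, and `|Θ_k(t,z)| ≤ M`. [folklore] -/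
theorem abs_assembledScalar_le_of_junction {t : ℝ} {z : E²} {k : ℕ} {M : ℝ} (hk : k + 1 < K)
    (h1 : χ k t z + χ (k + 1) t z = 1) (h0 : ∀ j < K, j ≠ k → j ≠ k + 1 → χ j t z = 0)
    (hΘk : Θ (k + 1) t z = Θ k t z) (hM : |Θ k t z| ≤ M) :
    |assembledScalar K χ Θ t z| ≤ M := by
  have e := (glue_eq_of_junction (Θ := fun j w => Θ j t w) (H := fun _ _ => (0 : ℝ)) (H₀ := 0) (x := z)
    hk h1 h0 hΘk rfl).1
  have e' : assembledScalar K χ Θ t z = Θ k t z := e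
  rw [e']; exact hM

/-- **Bound at a far point**: `|Θ(t,z)| ≤ M` for `M ≥ 0` if every product `χ_j Θ_j` vanishes at
`(t,z)`. [folklore] -/
theorem abs_assembledScalar_le_of_far {t : ℝ} {z : E²} {M : ℝ} (hM : 0 ≤ M)
    (h0 : ∀ j < K, χ j t z * Θ j t z = 0) : |assembledScalar K χ Θ t z| ≤ M := by
  rw [assembledScalar_apply, Finset.sum_eq_zero (fun j hj => h0 j (Finset.mem_range.1 hj)), abs_zero]
  exact hM

/-- **The assembled velocity vanishes where the stream function is locally the background**: if
near `z` (at time `t`) every product `χ_j (H_j - H₀)` vanishes, then `V(t, z) = 0`. Applied on the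
boundary strips of the square away from the gate windows this gives the vanishing, in particular
the tangency, of the assembled velocity there. [folklore] -/
theorem assembledVelocity_eq_zero_of_far {t : ℝ} {z : E²}
    (h0 : ∀ j < K, ∀ᶠ w in 𝓝 z, χ j t w * (H j t w - H₀) = 0) :
    assembledVelocity K H₀ χ H t z = 0 :=
  perpGrad_eq_zero_of_eventually_const (assembledStream_eq_const_of_far (χ := χ) (H := H) h0)

/-- **Local agreement with a prescribed pair** (the gate windows): at a core point of an element
`k` whose fields agree near `(t,z)` with a prescribed scalar `Θg` and stream function `Hg`, the
assembled scalar equals `Θg` at `(t,z)` and the assembled velocity is `∇⊥Hg(t,·)` at `z`.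
[folklore] -/
theorem assembled_eq_prescribed_of_core {t : ℝ} {z : E²} {k : ℕ} {Θg Hg : ℝ → E² → ℝ} (hk : k < K)
    (h1 : ∀ᶠ p in 𝓝 (t, z), χ k p.1 p.2 = 1)
    (h0 : ∀ j < K, j ≠ k → ∀ᶠ p in 𝓝 (t, z), χ j p.1 p.2 = 0)
    (hΘ : ∀ᶠ p in 𝓝 (t, z), Θ k p.1 p.2 = Θg p.1 p.2) (hH : ∀ᶠ p in 𝓝 (t, z), H k p.1 p.2 = Hg p.1 p.2) :
    assembledScalar K χ Θ t z = Θg t z ∧ assembledVelocity K H₀ χ H t z = perpGrad (Hg t) z := by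
  obtain ⟨eΘ, eH⟩ := assembled_eq_of_core (Θ := Θ) (H := H) (H₀ := H₀) hk h1 h0
  constructor
  · exact (eΘ.and hΘ).self_of_nhds.1.trans (eΘ.and hΘ).self_of_nhds.2
  · rw [assembledVelocity_apply]
    have e1 : assembledStream K H₀ χ H t =ᶠ[𝓝 z] H k t :=
      eventually_slice (P := fun s w => assembledStream K H₀ χ H s w = H k s w) eH
    have e2 : H k t =ᶠ[𝓝 z] Hg t := eventually_slice (P := fun s w => H k s w = Hg s w) hH
    exact perpGrad_congr (e1.trans e2)

end Assembly

end PlanarKinematics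

end Literature.Analysis.FluidPDE
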